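import Summits.ABC.IUTFork.Repair.RHRound4TLinearRho
import HarnessLib

/-!
# I-3 lens L1 («count O(h) not O(l·h)»), gen 2 — THE COUNT FLOOR (soundness window) in the R-H cell currency of record

abc-iut cell, crux `stmt-ABC-19678` `Summit.ABC.ABC.Theses.IUTThetaPilot.ThetaPartII`; seat abc-iut-idea-1 g2 (planner, crux-ideate
discipline; KEY `wake/KEY-abc-iut-idea-1-I3-LENS1.md` 787706d448f90a49). Companion to the memo `I3-LENS1-NO-MECHANISM-g2.md`.

WHAT IS TYPED. Over `Round4TLinear.Variant` (p545946: value law `f`, per-label identification COUNT `pk`, label set `J`, credit `μ₀`,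
prime `l`; `Estar V = 2l·Σ_J pk/(μ₀·S_f)`), the LOWER edge of the T-linear window, i.e. the reading of the lens target from BELOW:

* `six_le_Estar_iff` — `6 ≤ E⋆(V) ↔ 3·μ₀·S_f(J) ≤ l·Σ_J pk` (pure algebra; no scheme asserted). READING: a scheme whose realised
  Szpiro-shape exponent is `< 6` with sub-linear error is refuted by `Literature.Barriers.ABC.SzpiroEpsilonCannotBeDropped`
  (`masser1990_lowerBound`); so for a SOUND scheme the count is bounded BELOW by `3·μ₀·S_f/l` — with the theta value law `j²` on
  `{1…l⋆}` and `μ₀ = 1` that is `3·S₂(l⋆)/l`, while print's count is `Σ(j+1) = countPrint l`, and `countPrint l/(3·S₂/l) = u(l)/6`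
  (`countPrint_div_floor`) `= (l²+5l)/(l²+l−12) = 1 + (4l+12)/(l²+l−12)`.
* `floor_107` — at the beds' `l = 107`: floor `3·S₂(53)/107 = 152958/107 (= 1429.5…)` vs print `1484`; per label `152958/5671
  (= 26.97…)` vs print's average `28`; an «O(1)-per-label» count `K` (the lens's «O(h) not O(l·h)» with the theta value law kept)
  has `E⋆ = 11342·K/50986 (= 0.2225·K)` (`flat107_Estar`), `< 6` for every `K < 152958/5671`.

So, with the theta pilot's value law, print's procession count `(j+1)` ([IUTchIV] proof of Thm 1.10 Step (iv), tensor product of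
`j+1` copies indexed by `S±_{j+1}`; [IUTchIII] Prop 3.2) is within the factor `u(l)/6 = 1 + 4/l + O(1/l²)` of the MINIMUM count any
sound identification can have: the count is not a free variable of the bookkeeping — Masser below, «T linear» above. A smaller count
is available only together with a flatter VALUE law (lens L3), at constant ratio `Σpk/S_f` (exponent-neutral), which is not L1.

HONESTY: real arithmetic on OUR claim-tagged cell currency; a law fitted ≠ a theorem; computed ≠ proved; typed ≠ proved; an
identification object PROPOSED ≠ IUT repaired; nothing here asserts abc proved or refuted; NO side is taken on [IUTchIII] Cor 3.12 /
[IUTchIV] Thm 1.10 or on any author (D-0045). The link «`E⋆ < 6` ⇒ refuted by Masser» is a READING of the currency (prose), not a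
theorem of this file: the currency deliberately asserts no derivation.
-/

open Finset

set_option linter.dupNamespace false

namespace Summit.ABC.ABC.Cruxes.ThetaPartII.L1CountFloor

open Summit.ABC.IUTFork.Repair.RH.Round4TLinear
open Summit.ABC.IUTFork.Repair.RH.ReqsideWeightLaws

/-- **The lower edge of the window.** For every scheme `V` with `μ₀ > 0`, `S_f(J) > 0`, `l ≥ 1`:
`6 ≤ E⋆(V) ↔ 3·μ₀·S_f ≤ l·Σ_J pk`. [folklore] -/
theorem six_le_Estar_iff (V : Variant) (hμ : 0 < V.μ₀) (hS : 0 < S V) :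
    6 ≤ Estar V ↔ 3 * V.μ₀ * S V ≤ (V.l : ℝ) * countSum V := by
  unfold Estar
  rw [le_div_iff₀ (mul_pos hμ hS)]
  constructor <;> intro h <;> nlinarith

/-- **The upper edge, same algebra** (= `TLinear`, p545946): `E⋆(V) ≤ 6(1+ε) ↔ l·Σ_J pk ≤ 3·μ₀·(1+ε)·S_f`. [folklore] -/
theorem Estar_le_iff (V : Variant) (ε : ℝ) (hμ : 0 < V.μ₀) (hS : 0 < S V) :
    Estar V ≤ 6 * (1 + ε) ↔ (V.l : ℝ) * countSum V ≤ 3 * V.μ₀ * (1 + ε) * S V := by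
  unfold Estar
  rw [div_le_iff₀ (mul_pos hμ hS)]
  constructor <;> intro h <;> nlinarith

/-- **THE WINDOW**: a scheme that is both sound-by-Masser (`6 ≤ E⋆`) and «T linear» (`E⋆ ≤ 6(1+ε)`) has its total COUNT pinned:
`3μ₀S_f/l ≤ Σ_J pk ≤ 3μ₀(1+ε)S_f/l`. [folklore] -/
theorem count_window (V : Variant) (ε : ℝ) (hμ : 0 < V.μ₀) (hS : 0 < S V) (hl : 0 < V.l)
    (hlo : 6 ≤ Estar V) (hhi : Estar V ≤ 6 * (1 + ε)) :
    3 * V.μ₀ * S V / V.l ≤ countSum V ∧ countSum V ≤ 3 * V.μ₀ * (1 + ε) * S V / V.l := by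
  have hl' : (0 : ℝ) < V.l := by exact_mod_cast hl
  refine ⟨?_, ?_⟩
  · rw [div_le_iff₀ hl']
    have := (six_le_Estar_iff V hμ hS).1 hlo
    linarith
  · rw [le_div_iff₀ hl']
    have := (Estar_le_iff V ε hμ hS).1 hhi
    linarith

/-- **Print sits at `u(l)/6` above the floor**: `countPrint l / (3·S₂(l)/l) = u(l)/6` (`l ≥ 5`). [folklore] -/
theorem countPrint_div_floor {l : ℕ} (hl : 5 ≤ l) :
    countPrint l / (3 * S2 l / l) = uPrint l / 6 := by
  have hS2 := (S2_pos hl).ne'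
  have hl' : (l : ℝ) ≠ 0 := by exact_mod_cast (show l ≠ 0 by omega)
  unfold uPrint
  field_simp
  ring

/-- The «O(1) identifications per label» scheme of the lens, typed: theta value law `j²`, FLAT count `K` on every label of
`{1…53}`, `μ₀ = 1`, `l = 107`. A PARAMETER record; asserted of nothing. [folklore] -/
def flat107 (K : ℝ) : Variant := ⟨fun j => (j : ℤ) ^ 2, fun _ => K, Finset.Icc 1 53, 1, 107⟩

/-- `S_f` of the flat scheme is print's `S₂(53) = 50986` and its count is `53·K`. [folklore] -/
theorem flat107_S_count (K : ℝ) : S (flat107 K) = 50986 ∧ countSum (flat107 K) = 53 * K := by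
  refine ⟨?_, ?_⟩
  · unfold S flat107
    norm_num [Finset.sum_Icc_succ_top]
  · unfold countSum flat107
    simp [Finset.sum_const, Nat.card_Icc]

/-- **`E⋆` of the flat scheme**: `E⋆ = 2·107·53·K/50986 = 11342·K/50986 (= 0.2225·K)`; in particular `E⋆ < 6 ↔ K < 152958/5671
(= 26.97…)` — every «O(1) per label» count with the theta value law is below the Masser floor. [folklore] -/
theorem flat107_Estar (K : ℝ) : Estar (flat107 K) = 11342 * K / 50986 ∧ (Estar (flat107 K) < 6 ↔ K < 152958 / 5671) := by
  obtain ⟨hS, hC⟩ := flat107_S_count K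
  have hE : Estar (flat107 K) = 11342 * K / 50986 := by
    unfold Estar
    rw [hS, hC]
    simp only [flat107]
    push_cast
    ring
  refine ⟨hE, ?_⟩
  rw [hE]
  constructor <;> intro h <;> linarith

/-- **The floor at the beds' `l = 107`, in numbers**: floor `3·S₂(53)/107 = 152958/107` (total) and `152958/5671` (per label, `l⋆ = 53`);
print `1484` (total), `28` (per label); ratio `1484·107/152958 = u(107)/6 (= 1.0381…)`. [folklore] -/
theorem floor_107 : 3 * S2 107 / 107 = 152958 / 107 ∧ 3 * S2 107 / 107 / 53 = 152958 / 5671 ∧ countPrint 107 = 1484 ∧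
    countPrint 107 / 53 = 28 ∧ countPrint 107 / (3 * S2 107 / 107) = 1484 * 107 / 152958 := by
  obtain ⟨hC, hS, -⟩ := frey7_l107_rate
  rw [hC, hS]
  norm_num

end Summit.ABC.ABC.Cruxes.ThetaPartII.L1CountFloor
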